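/-
Copyright (c) 2026. All rights reserved.
Released under Apache 2.0 license as described in the file LICENSE.
-/
import Mathlib
import HarnessLib
import Literature.MathematicalPhysics.QuantumLattice.AbelianFieldTensor
import Literature.MathematicalPhysics.QuantumLattice.AbelianMagneticFlux
import Literature.MathematicalPhysics.QuantumFieldTheory.U1WardIdentity
import Summits.Ventures.LatticeQCDFlow.Scaling.SectorActionFloor
import Summits.Ventures.LatticeQCDFlow.Scaling.TangentLineBudget
import Summits.Ventures.LatticeQCDFlow.Scaling.FluxInsertionMountainPass

/-!
# The generic mountain pass of a flux insertion down to FOUR touched plaquettes (lean-1 GEN-7, own work)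

HONEST FRAMING: exact (Metropolis-corrected) sampling algorithms for lattice gauge theory;
figures of merit are autocorrelation/cost numbers at stated couplings and volumes; no
continuum-physics claim.

Venture `LatticeQCDFlow` (cell pub-lqcd), topic `Scaling`, FANOUT row 30 (lean-1).  NEW WORK of the
cell; nothing here is cited as a fact; no `def`.  `d = 2`, compact `U(1)`, torus `(ℤ/L)²`.

`Scaling/FluxInsertionMountainPass` (lean-1 GEN-6) proves the pointwise MOUNTAIN-PASS INEQUALITY
`max(S(U), S(WU)) ≥ N(1 − cos(α/2)) + M(1 − cos(π/M))` for an insertion `W` carrying plaquette angle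
`α = 2π/N` on `N` positions and `1` elsewhere (`M` = the number of untouched positions), for every
configuration `U` whose flux charge it changes, under `5 ≤ N ≤ M`.  The restriction `5 ≤ N` came
from the tangent-line bound of `1 − cos` at contact `α/2 = π/N`, which `Scaling/SectorActionFloor`
has for contacts `≤ 7/10 < π/4`.  theory2's item 108 (`Scaling/TangentLineBudget`,
`Trig.cos_le_tangent`) pushed the contact to `π/4` on the whole circle; with it the same argument
runs for `N = 4` (contact exactly `π/4`), the one case the wrapping-LINE insertion kernel needs at
volume `L = 4` (`N = L = 4`, `M = L² − L = 12`) and the last case of conjecture C9″c of the cell's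
THEORY-2.md §4 ("every `L ≥ 4`") left open by `Scaling/FluxInsertionLineHeightValue` (`L ≥ 5`).

CONTENTS.
* §1 `sum_tangent_le_of_le_pi_div_four`, `sum_tangent_le_neg_of_le_pi_div_four`: the summed signed
  tangent bounds `#s(1 − cos c) + sin c(±Σφᵢ − #s·c) ≤ Σ(1 − cos φᵢ)` for `φᵢ ∈ [−π, π]` and every
  contact `0 ≤ c ≤ π/4` (strictly extending the `c ≤ 7/10` forms of `SectorActionFloor`).
* §2 `sharpValue_le_jumpPrice_real_four`: `n(1 − cos(π/n)) + m(1 − cos(π/m)) ≤ 2(1 + cos(2π/n))`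
  for real `n ≥ 4`, `m ≥ 7` (the jump price at `N = 4` is `2(1 + cos(π/2)) = 2`; the companion of
  `sharpValue_le_jumpPrice_real`, which needs `n ≥ 5`).
* §3 `sharpValue_le_max_wilsonAction_of_exp_four`: THE GENERIC MOUNTAIN PASS for `4 ≤ N ≤ M` with
  `5 ≤ N ∨ 7 ≤ M` — a strict generalisation of `sharpValue_le_max_wilsonAction_of_exp` (`5 ≤ N ≤ M`);
  the new case is `N = 4`, `M ≥ 7`.
No `sorry`, standard axioms only.
-/

noncomputable section

open Real Set
open Literature.MathematicalPhysics.QuantumFieldTheory Literature.MathematicalPhysics.QuantumLattice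

namespace Summit.Ventures.LatticeQCDFlow.Theory2.Lattice.Flux

/-! ## §1 Summed tangent bounds at every contact `c ≤ π/4` -/

section Tangent

/-- **Summed tangent bound at contact `c ≤ π/4`**: for `φᵢ ∈ [−π, π]`,
`#s·(1 − cos c) + sin c·(Σ φᵢ − #s·c) ≤ Σ (1 − cos φᵢ)` (the tangent line of `cos` at `c` lies above
`cos` on the whole circle, `Trig.cos_le_tangent`). [folklore] -/
theorem sum_tangent_le_of_le_pi_div_four {ι : Type*} (s : Finset ι) (φ : ι → ℝ) {c : ℝ}
    (hc0 : 0 ≤ c) (hc : c ≤ π / 4) (hφ : ∀ i ∈ s, -π ≤ φ i ∧ φ i ≤ π) :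
    (s.card : ℝ) * (1 - Real.cos c) + Real.sin c * (∑ i ∈ s, φ i - s.card * c) ≤
      ∑ i ∈ s, (1 - Real.cos (φ i)) := by
  have e : (s.card : ℝ) * (1 - Real.cos c) + Real.sin c * (∑ i ∈ s, φ i - s.card * c) =
      ∑ i ∈ s, ((1 - Real.cos c) + Real.sin c * (φ i - c)) := by
    rw [Finset.sum_add_distrib, Finset.sum_const, nsmul_eq_mul, ← Finset.mul_sum,
      Finset.sum_sub_distrib, Finset.sum_const, nsmul_eq_mul]
  rw [e]
  exact Finset.sum_le_sum fun i hi => by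
    linarith [Trig.cos_le_tangent hc0 hc (hφ i hi).1 (hφ i hi).2]

/-- The reflected form at contact `c ≤ π/4`: `#s·(1 − cos c) + sin c·(−Σ φᵢ − #s·c) ≤ Σ (1 − cos φᵢ)`.
[folklore] -/
theorem sum_tangent_le_neg_of_le_pi_div_four {ι : Type*} (s : Finset ι) (φ : ι → ℝ) {c : ℝ}
    (hc0 : 0 ≤ c) (hc : c ≤ π / 4) (hφ : ∀ i ∈ s, -π ≤ φ i ∧ φ i ≤ π) :
    (s.card : ℝ) * (1 - Real.cos c) + Real.sin c * (-∑ i ∈ s, φ i - s.card * c) ≤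
      ∑ i ∈ s, (1 - Real.cos (φ i)) := by
  have h := sum_tangent_le_of_le_pi_div_four s (fun i => -φ i) hc0 hc
    (fun i hi => ⟨by linarith [(hφ i hi).2], by linarith [(hφ i hi).1]⟩)
  simp only [Real.cos_neg, Finset.sum_neg_distrib] at h
  exact h

end Tangent

/-! ## §2 The jump price at `N = 4` -/

section Arith

/-- **The conjectured value never exceeds the jump price, `n ≥ 4`**: for real `n ≥ 4`, `m ≥ 7`,
`n(1 − cos(π/n)) + m(1 − cos(π/m)) ≤ 2(1 + cos(2π/n))`
(`lhs ≤ π²/8 + π²/14 < 1.95`, `rhs ≥ 2` since `2π/n ≤ π/2`). [folklore] -/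
theorem sharpValue_le_jumpPrice_real_four {n m : ℝ} (hn4 : 4 ≤ n) (hm7 : 7 ≤ m) :
    n * (1 - Real.cos (π / n)) + m * (1 - Real.cos (π / m)) ≤ 2 * (1 + Real.cos (2 * π / n)) := by
  have h1 : n * (1 - Real.cos (π / n)) ≤ π ^ 2 / 8 := by
    have hc : 1 - (π / n) ^ 2 / 2 ≤ Real.cos (π / n) := Real.one_sub_sq_div_two_le_cos
    have e : n * ((π / n) ^ 2 / 2) = π ^ 2 / (2 * n) := by field_simp
    calc n * (1 - Real.cos (π / n)) ≤ n * ((π / n) ^ 2 / 2) :=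
          mul_le_mul_of_nonneg_left (by linarith) (by linarith)
      _ = π ^ 2 / (2 * n) := e
      _ ≤ π ^ 2 / 8 := div_le_div_of_nonneg_left (by positivity) (by norm_num) (by linarith)
  have h2 : m * (1 - Real.cos (π / m)) ≤ π ^ 2 / 14 := by
    have hc : 1 - (π / m) ^ 2 / 2 ≤ Real.cos (π / m) := Real.one_sub_sq_div_two_le_cos
    have e : m * ((π / m) ^ 2 / 2) = π ^ 2 / (2 * m) := by field_simp
    calc m * (1 - Real.cos (π / m)) ≤ m * ((π / m) ^ 2 / 2) :=
          mul_le_mul_of_nonneg_left (by linarith) (by linarith)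
      _ = π ^ 2 / (2 * m) := e
      _ ≤ π ^ 2 / 14 := div_le_div_of_nonneg_left (by positivity) (by norm_num) (by linarith)
  have h3 : 0 ≤ Real.cos (2 * π / n) := by
    refine Real.cos_nonneg_of_mem_Icc ⟨by linarith [Real.pi_pos, show 0 ≤ 2 * π / n by positivity], ?_⟩
    rw [div_le_iff₀ (by linarith)]
    nlinarith [Real.pi_pos]
  have hπ : π ^ 2 < 9.9225 := by nlinarith [Real.pi_lt_d2, Real.pi_pos]
  linarith [h1, h2, h3, hπ]

end Arith

/-! ## §3 The generic mountain pass for `N ≥ 4` touched plaquettes -/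

section Generic

variable {L : ℕ} [NeZero L]

/-- **THE GENERIC MOUNTAIN-PASS INEQUALITY, `N ≥ 4`.**  Let the insertion `W` carry plaquette angle
`α > 0` on the `N` positions of `R` and `0` elsewhere, `Nα = 2π`, `4 ≤ N ≤ M = #Rᶜ`, and
`5 ≤ N` or `7 ≤ M`.  Then for EVERY configuration `U` with `Q(WU) ≠ Q(U)`:
`max(S(U), S(WU)) ≥ N(1 − cos(α/2)) + M(1 − cos(π/M))`.  (The case `5 ≤ N` is
`sharpValue_le_max_wilsonAction_of_exp`; the new case is `N = 4`, contact angle `π/4`.) [folklore] -/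
theorem sharpValue_le_max_wilsonAction_of_exp_four (W U : GaugeConfig 2 L Circle)
    (R : Finset (Site 2 L)) {α : ℝ}
    (hW : ∀ x, plaquetteHolonomy W x 0 1 = Circle.exp (if x ∈ R then α else 0))
    (hα0 : 0 < α) (hNα : (R.card : ℝ) * α = 2 * π) (hN4 : 4 ≤ R.card) (hNM : R.card ≤ Rᶜ.card)
    (hor : 5 ≤ R.card ∨ 7 ≤ Rᶜ.card)
    (hne : topCharge (0 : Site 2 L) 0 1 (W * U) ≠ topCharge (0 : Site 2 L) 0 1 U) :
    (R.card : ℝ) * (1 - Real.cos (α / 2)) +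
        (Rᶜ.card : ℝ) * (1 - Real.cos (π / (Rᶜ.card : ℝ))) ≤
      max (wilsonAction u1Rep U) (wilsonAction u1Rep (W * U)) := by
  classical
  rcases hor with hN5 | hM7
  · exact sharpValue_le_max_wilsonAction_of_exp W U R hW hα0 hNα hN5 hNM hne
  obtain ⟨n, hn⟩ : ∃ n : ℝ, (R.card : ℝ) = n := ⟨_, rfl⟩
  obtain ⟨mM, hmM⟩ : ∃ mM : ℝ, (Rᶜ.card : ℝ) = mM := ⟨_, rfl⟩
  have hn4 : (4 : ℝ) ≤ n := by rw [← hn]; exact_mod_cast hN4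
  have hnm : n ≤ mM := by rw [← hn, ← hmM]; exact_mod_cast hNM
  have hm7 : (7 : ℝ) ≤ mM := by rw [← hmM]; exact_mod_cast hM7
  rw [hn, hmM]
  have hnα : n * α = 2 * π := by rw [← hn]; exact hNα
  have hα : α = 2 * π / n := by
    rw [eq_div_iff (by linarith : n ≠ 0)]; linarith
  have hα4 : α ≤ 2 * π / 4 := by
    rw [hα]; exact div_le_div_of_nonneg_left (by positivity) (by norm_num) hn4
  have hαπ : α < π := by nlinarith [Real.pi_pos]
  set a : Site 2 L → ℝ := fun x => if x ∈ R then α else 0 with ha_def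
  have ha : ∀ x, 0 ≤ a x ∧ a x < π := by
    intro x; simp only [ha_def]; split_ifs <;> constructor <;> linarith [Real.pi_pos]
  have haα : ∀ x, a x ≤ α := by
    intro x; simp only [ha_def]; split_ifs <;> linarith
  have hj := fun x => exists_jump_mul W U a hW ha x
  choose m hm01 hm using hj
  have hsuma : ∑ x : Site 2 L, a x = 2 * π := by
    rw [← Finset.sum_add_sum_compl R]
    rw [Finset.sum_congr rfl fun x (hx : x ∈ R) => show a x = α from if_pos hx,
      Finset.sum_eq_zero fun x (hx : x ∈ Rᶜ) => show a x = 0 from if_neg (Finset.mem_compl.mp hx),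
      Finset.sum_const, nsmul_eq_mul, add_zero, hNα]
  have hQ := topCharge_mul_eq_of_jumps W U a m hm
  rw [hsuma, div_self (by positivity : (2 : ℝ) * π ≠ 0)] at hQ
  -- the sum of the jumps is an integer `≠ -1`, each jump is `0` or `-1`
  have hsum_ne : (∑ x : Site 2 L, m x) ≠ -1 := by
    intro h
    have h' : (∑ x : Site 2 L, (m x : ℝ)) = -1 := by exact_mod_cast h
    rw [h'] at hQ
    exact hne (by rw [hQ]; ring)
  by_cases hall : ∀ x, m x = 0
  · -- no jump: the angles add
    have hF' : ∀ x : Site 2 L, abelianFieldTensor (W * U) x 0 1 =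
        abelianFieldTensor U x 0 1 + a x := by
      intro x; rw [hm x, hall x]; simp
    set F : Site 2 L → ℝ := fun x => abelianFieldTensor U x 0 1 with hF
    have hFb : ∀ x, -π ≤ F x ∧ F x ≤ π :=
      fun x => ⟨(neg_pi_lt_abelianFieldTensor U x 0 1).le, abelianFieldTensor_le_pi U x 0 1⟩
    -- the two actions, split over `R` and `Rᶜ`
    have hSU : wilsonAction u1Rep U =
        ∑ x ∈ R, (1 - Real.cos (F x)) + ∑ x ∈ Rᶜ, (1 - Real.cos (F x)) := by
      rw [wilsonAction_eq_sum_site, ← Finset.sum_add_sum_compl R]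
    have hSW : wilsonAction u1Rep (W * U) =
        ∑ x ∈ R, (1 - Real.cos (F x + α)) + ∑ x ∈ Rᶜ, (1 - Real.cos (F x)) := by
      rw [wilsonAction_eq_sum_site, ← Finset.sum_add_sum_compl R]
      congr 1
      · refine Finset.sum_congr rfl fun x hx => ?_
        rw [hF', show a x = α from if_pos hx]
      · refine Finset.sum_congr rfl fun x hx => ?_
        rw [hF', show a x = 0 from if_neg (Finset.mem_compl.mp hx), add_zero]
    -- flux quantisation
    obtain ⟨q, hq⟩ := exists_int_sum_site_eq U
    rw [← Finset.sum_add_sum_compl R] at hq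
    set σ := ∑ x ∈ R, F x with hσ
    set τ := ∑ x ∈ Rᶜ, F x with hτ
    -- the tangent bounds, now at contacts `α/2 = π/n ≤ π/4` and `π/M ≤ π/7`
    have hα2 : α / 2 = π / n := by rw [hα]; ring
    have hc1 : 0 ≤ α / 2 := by linarith
    have hc1' : α / 2 ≤ π / 4 := by linarith
    have hc2 : 0 ≤ π / mM := by positivity
    have hc2' : π / mM ≤ π / 4 :=
      div_le_div_of_nonneg_left Real.pi_pos.le (by norm_num) (by linarith)
    have B1 := sum_tangent_le_of_le_pi_div_four R (fun x => F x + α) hc1 hc1' (fun x hx => by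
      have h1 := neg_pi_lt_abelianFieldTensor (W * U) x 0 1
      have h2 := abelianFieldTensor_le_pi (W * U) x 0 1
      rw [hF', show a x = α from if_pos hx] at h1 h2
      exact ⟨h1.le, h2⟩)
    have B2 := sum_tangent_le_neg_of_le_pi_div_four R F hc1 hc1' (fun x _ => hFb x)
    have B3 := sum_tangent_le_of_le_pi_div_four Rᶜ F hc2 hc2' (fun x _ => hFb x)
    have B4 := sum_tangent_le_neg_of_le_pi_div_four Rᶜ F hc2 hc2' (fun x _ => hFb x)
    simp only [Finset.sum_add_distrib, Finset.sum_const, nsmul_eq_mul] at B1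
    rw [hn] at B1 B2
    rw [hmM] at B3 B4
    have e1 : mM * (π / mM) = π := by field_simp
    rw [e1] at B3 B4
    have hsin1 : 0 ≤ Real.sin (π / mM) :=
      Real.sin_nonneg_of_nonneg_of_le_pi hc2 (by linarith [Real.pi_pos])
    have hsin2 : Real.sin (π / mM) ≤ Real.sin (α / 2) := by
      rw [hα2]
      exact Real.sin_le_sin_of_le_of_le_pi_div_two (by linarith [Real.pi_pos])
        (by rw [div_le_iff₀ (by linarith)]; nlinarith [Real.pi_pos])
        (div_le_div_of_nonneg_left Real.pi_pos.le (by linarith) hnm)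
    have e2 : σ + n * α - n * (α / 2) = σ + π := by linarith
    have e3 : -σ - n * (α / 2) = -σ - π := by linarith
    rw [e2] at B1
    rw [e3] at B2
    have hqZ : (q : ℝ) ≤ -1 ∨ 0 ≤ (q : ℝ) := by
      rcases le_or_gt 0 q with h | h
      · exact Or.inr (by exact_mod_cast h)
      · exact Or.inl (by exact_mod_cast (show q ≤ -1 by omega))
    rw [hSU, hSW]
    exact mountainPass_arith hsin1 hsin2 hq hqZ B1 B2 B3 B4
  · -- a jump: `Σ m ≤ -2`, and each jump costs `1 + cos α`
    push Not at hall
    obtain ⟨x₀, hx₀⟩ := hall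
    have hle0 : ∀ x, m x ≤ 0 := fun x => by rcases hm01 x with h | h <;> omega
    have hsum2 : (∑ x : Site 2 L, m x) ≤ -2 := by
      have hx₀' : m x₀ = -1 := (hm01 x₀).resolve_left hx₀
      have h1 : (∑ x : Site 2 L, m x) = m x₀ + ∑ x ∈ Finset.univ.erase x₀, m x :=
        (Finset.add_sum_erase Finset.univ m (Finset.mem_univ x₀)).symm
      have h2 : ∑ x ∈ Finset.univ.erase x₀, m x ≤ 0 := Finset.sum_nonpos fun x _ => hle0 x
      omega
    have hterm : ∀ x : Site 2 L, -(m x : ℝ) * (1 + Real.cos α) ≤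
        1 - Real.cos (abelianFieldTensor U x 0 1) := by
      intro x
      rcases hm01 x with h0 | h1
      · rw [h0, Int.cast_zero, neg_zero, zero_mul]
        linarith [Real.cos_le_one (abelianFieldTensor U x 0 1)]
      · have hx := hm x
        rw [h1] at hx
        rw [h1, Int.cast_neg, Int.cast_one, neg_neg, one_mul]
        exact one_add_cos_le_of_jump_mul (haα x) hαπ.le hx
    have hS : 2 * (1 + Real.cos α) ≤ wilsonAction u1Rep U := by
      rw [wilsonAction_eq_sum_site]
      refine le_trans ?_ (Finset.sum_le_sum fun x _ => hterm x)
      rw [← Finset.sum_mul, Finset.sum_neg_distrib]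
      have h2 : (2 : ℝ) ≤ -∑ x : Site 2 L, (m x : ℝ) := by
        have : ((∑ x : Site 2 L, m x : ℤ) : ℝ) ≤ -2 := by exact_mod_cast hsum2
        push_cast at this
        linarith
      have hc : 0 ≤ 1 + Real.cos α := by linarith [Real.neg_one_le_cos α]
      nlinarith [mul_le_mul_of_nonneg_right h2 hc]
    have hj := sharpValue_le_jumpPrice_real_four hn4 hm7
    rw [← hα] at hj
    have hα2 : α / 2 = π / n := by rw [hα]; ring
    rw [hα2]
    exact le_max_of_le_left (hj.trans hS)

end Generic

end Summit.Ventures.LatticeQCDFlow.Theory2.Lattice.Flux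

end
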